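import Literature.AlgebraicTopology.SingularHomology.ChartTransitionLocalDegree
import Literature.AlgebraicTopology.SingularHomology.LocalClassFamilies
import HarnessLib

/-!
# The `ℤ`-orientation of a manifold with a positive atlas

A. Hatcher, *Algebraic Topology* (2002), §3.3 pp. 233–236, and G. Bredon, *Topology and Geometry*
(1993), VI.7 Prop. 7.14–Thm. 7.15: a topological `n`-manifold whose atlas has transition maps
that are differentiable with Jacobians of POSITIVE determinant is `ℤ`-orientable, the local
orientation at `y` being the generator of `Hₙ(ℝⁿ | c y; ℤ)` pulled back along any chart `c` of the
atlas at `y` ("an oriented atlas orients the manifold"; Milnor–Stasheff 1974, App. A, for the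
smooth case; the complex-manifold case — holomorphic atlases are positive since
`det_ℝ = |det_ℂ|² > 0` — is Milnor–Stasheff §13 p. 151 / Huybrechts Cor. 1.2.3).

This file proves it for an arbitrary charted space (no smooth structure, no tangent bundle is
needed: only the pointwise Jacobians of the transition maps), assembling PROVED results of the
tree (`…ChartTransitionLocalDegree`: `chartXEquiv_symm_localClass_eq_of_hasFDerivAt`,
`exists_mem_nhds_restrictToPoint_eq_chartXEquiv_symm`; `…LocalClassFamilies`:
`HomologicalOrientation.ofLocalFamily`):

* `IsPositiveAtlas n X` — every transition map `c ∘ c'⁻¹` of the atlas is differentiable at every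
  point of its domain with a Jacobian of positive determinant;
* `chartRefFamily g` — the family of reference classes `y ↦ (c_y)^* g_{c_y y}`, `c_y` the
  preferred chart at `y`; `chartRefFamily_eq_of_mem_atlas` — on a positive atlas it may be computed
  in ANY chart of the atlas at `y` (change of chart is the sign of the Jacobian);
* **`positiveAtlasOrientation`** — the resulting `ℤ`-orientation; `…_localClass_eq` (its local
  class in any atlas chart), `…_localClass_restrOpen` (or a restriction of one);
* `relativeSingularHomology.xEquiv_symm_apply` — the inverse of the cross-universe transport along
  `e` is the transport along `e.symm`; `localHomology.xEquiv_xEquiv_symm` — the round trip is the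
  transport along the identity — and the consequence used by intersection-number computations
  (`TransverseDiscDatum.functional_ofAbsolute_map_eq_sum` takes Euclidean models `e : V ≃ₜ U`
  pushing model classes FORWARD): **`positiveAtlasOrientation_localClass_symm`**, the local class at
  `c⁻¹ w` is the push-forward along `c⁻¹ : c.target ≃ₜ c.source` of the model class at `w`,
  included into `X`.

Everything is proved; no definitions of `Prop`s as facts.

## References

* A. Hatcher, *Algebraic Topology*, CUP 2002, §3.3 pp. 233–236, Lemma 3.27. [HatcherAT2002]
* G. E. Bredon, *Topology and Geometry*, GTM 139, Springer 1993, VI.7. [Bredon1993]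
* J. Milnor, J. Stasheff, *Characteristic Classes*, Princeton 1974, §13 p. 151, Appendix A.
  [MilnorStasheff1974]
-/

noncomputable section

open CategoryTheory Set Filter Topology

universe u u'

namespace Literature.AlgebraicTopology.SingularHomology

/-! ### The inverse of the transport along a homeomorphism -/

section XEquivSymm

variable (R : Type) [CommRing R] (M : Type) [AddCommGroup M] [Module R M]
variable {X : Type u} {Y : Type u'} [TopologicalSpace X] [TopologicalSpace Y]

-- chains of the concrete complexes are `Finsupp`s up to unfolding
set_option backward.isDefEq.respectTransparency false in
/-- The degreewise maps of the transport along `e⁻¹` and of the inverse of the transport along `e`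
agree. [cite: HatcherAT2002, §2.1] -/
theorem relativeConcrete.xEquiv_symm_e (e : X ≃ₜ Y) {A : Set X} {B : Set Y}
    (hAB : MapsTo e A B) (hBA : MapsTo e.symm B A) (hAB' : MapsTo e.symm.symm A B)
    (i : ℕ) (x : (chainsInSub R M Y B).quotient.X i) :
    (relativeConcrete.xEquiv R M e.symm hBA hAB').e i x =
      (relativeConcrete.xEquiv R M e hAB hBA).symm.e i x := by
  change (relativeConcrete.xEquiv R M e.symm hBA hAB').e i x =
    ((relativeConcrete.xEquiv R M e hAB hBA).e i).symm x
  rw [LinearEquiv.eq_symm_apply]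
  obtain ⟨c, rfl⟩ := (chainsInSub R M Y B).π_f_surjective i x
  rw [relativeConcrete.xEquiv_e_π, relativeConcrete.xEquiv_e_π]
  congr 1
  exact CChain.push_push_symm R M e.symm c

/-- **The inverse of the cross-universe transport `Hₙ(X, A) ≃ Hₙ(Y, B)` along `e` is the
transport along `e⁻¹`** (both are induced by `ρ ↦ e⁻¹ ∘ ρ` on simplices; Hatcher 2002, §2.1,
functoriality in homeomorphisms of pairs). [cite: HatcherAT2002, §2.1] -/
theorem relativeSingularHomology.xEquiv_symm_apply (e : X ≃ₜ Y) {A : Set X} {B : Set Y}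
    (hAB : MapsTo e A B) (hBA : MapsTo e.symm B A) (hAB' : MapsTo e.symm.symm A B) (n : ℕ)
    (y : relativeSingularHomology R M Y B n) :
    (relativeSingularHomology.xEquiv R M e hAB hBA n).symm y =
      relativeSingularHomology.xEquiv R M e.symm hBA hAB' n y := by
  set E := relativeConcrete.xEquiv R M e hAB hBA with hE
  set E' := relativeConcrete.xEquiv R M e.symm hBA hAB' with hE'
  have hhe : ∀ z, E'.homologyEquiv n z = (E.homologyEquiv n).symm z := fun z => by
    have key := ComplexXEquiv.homologyEquiv_homologyMap (E := E.symm) (F := E') (𝟙 _) (𝟙 _)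
      (fun i x => by
        rw [HomologicalComplex.id_f, ModuleCat.id_apply, HomologicalComplex.id_f,
          ModuleCat.id_apply, hE', hE, relativeConcrete.xEquiv_symm_e R M e hAB hBA hAB']) n z
    simp only [HomologicalComplex.homologyMap_id, ModuleCat.id_apply] at key
    rw [key, E.homologyEquiv_symm_apply]
  rw [LinearEquiv.symm_apply_eq]
  simp only [relativeSingularHomology.xEquiv, LinearEquiv.trans_apply, Iso.toLinearEquiv_apply,
    Iso.symm_hom]
  rw [← hE, ← hE', Iso.inv_hom_id_apply, hhe, LinearEquiv.apply_symm_apply, Iso.hom_inv_id_apply]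

/-- **The round trip `Hₙ(B | b) → Hₙ(A | e⁻¹ b) → Hₙ(B | e (e⁻¹ b))` is the transport along the
identity of `B`** (the two complements `B ∖ b` and `B ∖ e (e⁻¹ b)` agree). [cite: HatcherAT2002, §3.3 p. 231] -/
theorem localHomology.xEquiv_xEquiv_symm (e : X ≃ₜ Y) (b : Y) (n : ℕ)
    (v : localHomology R M Y b n)
    (hid : MapsTo (ContinuousMap.id Y) ({b}ᶜ : Set Y) ({e (e.symm b)}ᶜ : Set Y)) :
    localHomology.xEquiv R M e (e.symm b) n (localHomology.xEquiv R M e.symm b n v) =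
      relativeSingularHomology.map R M (ContinuousMap.id Y) hid n v := by
  -- the inner transport is the inverse of the transport along `e` (with complements `{e⁻¹ b}ᶜ`, `{b}ᶜ`)
  have h1 : localHomology.xEquiv R M e.symm b n v =
      (relativeSingularHomology.xEquiv R M e (mapsTo_symm_compl_singleton e.symm.toEquiv b)
        (mapsTo_compl_singleton e.symm.toEquiv b) n).symm v :=
    (relativeSingularHomology.xEquiv_symm_apply R M e _ _
      (mapsTo_symm_compl_singleton e.symm.toEquiv b) n v).symm
  rw [h1]
  -- move the complement of the target point from `{b}ᶜ` to `{e (e⁻¹ b)}ᶜ` by naturality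
  have nat := relativeSingularHomology.xEquiv_map R M e e (ContinuousMap.id X) (ContinuousMap.id Y)
    (fun _ => rfl) (mapsTo_symm_compl_singleton e.symm.toEquiv b)
    (mapsTo_compl_singleton e.symm.toEquiv b) (mapsTo_compl_singleton e.toEquiv (e.symm b))
    (mapsTo_symm_compl_singleton e.toEquiv (e.symm b)) (mapsTo_id _) hid n
    ((relativeSingularHomology.xEquiv R M e (mapsTo_symm_compl_singleton e.symm.toEquiv b)
        (mapsTo_compl_singleton e.symm.toEquiv b) n).symm v)
  rw [relativeSingularHomology.map_id, ModuleCat.id_apply, LinearEquiv.apply_symm_apply] at nat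
  exact nat

end XEquivSymm

/-! ### Positive atlases and their reference classes -/

section PositiveAtlas

variable {n : ℕ} {X : Type u} [TopologicalSpace X] [ChartedSpace (EuclideanSpace ℝ (Fin n)) X]

omit [TopologicalSpace X] [ChartedSpace (EuclideanSpace ℝ (Fin n)) X] in
/-- **A positive atlas** (a predicate on charted spaces, not a named fact): every transition map
`c ∘ c'⁻¹` between charts of the atlas of the charted space `Y` is differentiable at every point
`c' y`, `y ∈ c.source ∩ c'.source`, with a Jacobian of positive determinant (an "oriented atlas",
Bredon 1993, VI.7; Milnor–Stasheff 1974, App. A; for holomorphic atlases Milnor–Stasheff §13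
p. 151). [cite: Bredon1993, VI.7] -/
def IsPositiveAtlas (n : ℕ) (Y : Type u) [TopologicalSpace Y]
    [ChartedSpace (EuclideanSpace ℝ (Fin n)) Y] : Prop :=
  ∀ c ∈ atlas (EuclideanSpace ℝ (Fin n)) Y, ∀ c' ∈ atlas (EuclideanSpace ℝ (Fin n)) Y,
    ∀ y ∈ c.source ∩ c'.source,
      ∃ A : EuclideanSpace ℝ (Fin n) →L[ℝ] EuclideanSpace ℝ (Fin n),
        HasFDerivAt (fun v => c (c'.symm v)) A (c' y) ∧
          0 < LinearMap.det (A : EuclideanSpace ℝ (Fin n) →ₗ[ℝ] EuclideanSpace ℝ (Fin n))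

variable [T2Space X]

/-- **The reference family of a charted space**: at `y`, the generator `g_{c y}` pulled back along
the preferred chart `c = chartAt y` (Hatcher 2002, §3.3 p. 233; `localHomology.chartXEquiv`).
[cite: HatcherAT2002, §3.3 p. 233] -/
def chartRefFamily (g : HomologicalOrientation ℤ (EuclideanSpace ℝ (Fin n)) n) :
    LocalFamily ℤ ℤ X n := fun y =>
  (localHomology.chartXEquiv ℤ ℤ (chartAt (EuclideanSpace ℝ (Fin n)) y)
      (mem_chart_source (EuclideanSpace ℝ (Fin n)) y) n).symm
    (g.localClass (chartAt (EuclideanSpace ℝ (Fin n)) y y))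

/-- Unfolding `chartRefFamily`. [folklore] -/
theorem chartRefFamily_apply (g : HomologicalOrientation ℤ (EuclideanSpace ℝ (Fin n)) n) (y : X) :
    chartRefFamily g y = (localHomology.chartXEquiv ℤ ℤ (chartAt (EuclideanSpace ℝ (Fin n)) y)
      (mem_chart_source (EuclideanSpace ℝ (Fin n)) y) n).symm
      (g.localClass (chartAt (EuclideanSpace ℝ (Fin n)) y y)) := rfl

/-- **On a positive atlas the reference class at `y` may be computed in any chart of the atlas at
`y`**: change of chart is the sign of the Jacobian (`chartXEquiv_symm_localClass_eq_of_hasFDerivAt`),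
here `+1`. [cite: Bredon1993, VI.7] -/
theorem chartRefFamily_eq_of_mem_atlas (hX : IsPositiveAtlas n X)
    (g : HomologicalOrientation ℤ (EuclideanSpace ℝ (Fin n)) n)
    {c : OpenPartialHomeomorph X (EuclideanSpace ℝ (Fin n))}
    (hc : c ∈ atlas (EuclideanSpace ℝ (Fin n)) X) {y : X} (hy : y ∈ c.source) :
    chartRefFamily g y = (localHomology.chartXEquiv ℤ ℤ c hy n).symm (g.localClass (c y)) := by
  obtain ⟨A, hA, hdet⟩ := hX c hc (chartAt (EuclideanSpace ℝ (Fin n)) y)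
    (chart_mem_atlas (EuclideanSpace ℝ (Fin n)) y) y
    ⟨hy, mem_chart_source (EuclideanSpace ℝ (Fin n)) y⟩
  rw [chartRefFamily_apply, chartXEquiv_symm_localClass_eq_of_hasFDerivAt g c
    (chartAt (EuclideanSpace ℝ (Fin n)) y) hy (mem_chart_source (EuclideanSpace ℝ (Fin n)) y)
    hA hdet.ne', if_pos hdet]

omit [T2Space X] in
/-- The reference classes are generators. [cite: HatcherAT2002, §3.3 p. 231] -/
theorem isGenerator_chartRefFamily [T2Space X]
    (g : HomologicalOrientation ℤ (EuclideanSpace ℝ (Fin n)) n)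
    (y : X) : ∃ e : localHomology ℤ ℤ X y n ≃ₗ[ℤ] ℤ, e (chartRefFamily g y) = 1 :=
  isGenerator_chartXEquiv_symm_localClass g _ _

/-- **On a positive atlas the reference family is locally consistent** (Hatcher 2002, §3.3
p. 235): near `x` it is the family of reference classes of the single chart `chartAt x`
(`chartRefFamily_eq_of_mem_atlas`), which are the restrictions of one class
(`exists_mem_nhds_restrictToPoint_eq_chartXEquiv_symm`). [cite: HatcherAT2002, §3.3 p. 235] -/
theorem consistentOn_chartRefFamily (hX : IsPositiveAtlas n X)
    (g : HomologicalOrientation ℤ (EuclideanSpace ℝ (Fin n)) n) (x : X) :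
    ∃ N ∈ 𝓝 x, (chartRefFamily g).ConsistentOn N := by
  obtain ⟨K, hK, -, hKc, N, hN⟩ := exists_mem_nhds_restrictToPoint_eq_chartXEquiv_symm g
    (chartAt (EuclideanSpace ℝ (Fin n)) x) (mem_chart_source (EuclideanSpace ℝ (Fin n)) x)
    Filter.univ_mem
  exact ⟨K, hK, N, fun y hy => by
    rw [hN y hy, chartRefFamily_eq_of_mem_atlas hX g
      (chart_mem_atlas (EuclideanSpace ℝ (Fin n)) x) (hKc hy)]⟩

/-- **The `ℤ`-orientation of a manifold with a positive atlas** (Bredon 1993, VI.7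
Prop. 7.14–Thm. 7.15; Milnor–Stasheff 1974, App. A; Hatcher 2002, §3.3 p. 233): the reference
family `y ↦ (chartAt y)^* g` is a locally consistent family of generators.
[cite: Bredon1993, VI.7] -/
def positiveAtlasOrientation (hX : IsPositiveAtlas n X)
    (g : HomologicalOrientation ℤ (EuclideanSpace ℝ (Fin n)) n) : HomologicalOrientation ℤ X n :=
  HomologicalOrientation.ofLocalFamily (chartRefFamily g) (isGenerator_chartRefFamily g)
    (consistentOn_chartRefFamily hX g)

/-- The local classes of `positiveAtlasOrientation` are the reference classes. [folklore] -/
@[simp]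
theorem positiveAtlasOrientation_localClass (hX : IsPositiveAtlas n X)
    (g : HomologicalOrientation ℤ (EuclideanSpace ℝ (Fin n)) n) (y : X) :
    (positiveAtlasOrientation hX g).localClass y = chartRefFamily g y := rfl

/-- **The local class of the orientation of a positive atlas in any chart of the atlas**:
`μ_y = c^* g_{c y}` for `c ∈ atlas`, `y ∈ c.source`. [cite: Bredon1993, VI.7] -/
theorem positiveAtlasOrientation_localClass_eq (hX : IsPositiveAtlas n X)
    (g : HomologicalOrientation ℤ (EuclideanSpace ℝ (Fin n)) n)
    {c : OpenPartialHomeomorph X (EuclideanSpace ℝ (Fin n))}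
    (hc : c ∈ atlas (EuclideanSpace ℝ (Fin n)) X) {y : X} (hy : y ∈ c.source) :
    (positiveAtlasOrientation hX g).localClass y =
      (localHomology.chartXEquiv ℤ ℤ c hy n).symm (g.localClass (c y)) :=
  chartRefFamily_eq_of_mem_atlas hX g hc hy

/-- The same for the restriction `c.restrOpen W` of an atlas chart to an open set `W ∋ y` (the
chart identification only depends on the germ of the chart, `chartXEquiv_restrOpen`). [folklore] -/
theorem positiveAtlasOrientation_localClass_restrOpen (hX : IsPositiveAtlas n X)
    (g : HomologicalOrientation ℤ (EuclideanSpace ℝ (Fin n)) n)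
    {c : OpenPartialHomeomorph X (EuclideanSpace ℝ (Fin n))}
    (hc : c ∈ atlas (EuclideanSpace ℝ (Fin n)) X) {W : Set X} (hW : IsOpen W) {y : X}
    (hy : y ∈ (c.restrOpen W hW).source) :
    (positiveAtlasOrientation hX g).localClass y =
      (localHomology.chartXEquiv ℤ ℤ (c.restrOpen W hW) hy n).symm
        (g.localClass (c.restrOpen W hW y)) := by
  have hy' : y ∈ c.source ∩ W := by rwa [c.restrOpen_source] at hy
  rw [positiveAtlasOrientation_localClass_eq hX g hc hy'.1, LinearEquiv.eq_symm_apply]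
  change localHomology.chartXEquiv ℤ ℤ (c.restrOpen W hW) _ n
      ((localHomology.chartXEquiv ℤ ℤ c hy'.1 n).symm (g.localClass (c y))) = g.localClass (c y)
  rw [chartXEquiv_restrOpen c hW hy'.1 hy'.2 n, LinearEquiv.apply_symm_apply]

/-! ### The local classes as push-forwards from the model: the form used by intersection numbers -/

omit [ChartedSpace (EuclideanSpace ℝ (Fin n)) X] [T2Space X] in
/-- Transport of the excised model class along an equality of points of an open subset of the
model (bookkeeping). [folklore] -/
theorem map_id_openSubsetIso_inv_localClass (g : HomologicalOrientation ℤ (EuclideanSpace ℝ (Fin n)) n)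
    {O : Set (EuclideanSpace ℝ (Fin n))} (hO : IsOpen O) (r r' : ↥O) (e : r = r')
    (hid : MapsTo (ContinuousMap.id ↥O) ({r}ᶜ : Set ↥O) ({r'}ᶜ : Set ↥O)) :
    relativeSingularHomology.map ℤ ℤ (ContinuousMap.id ↥O) hid n
        ((localHomology.openSubsetIso ℤ ℤ hO r.2 n).inv (g.localClass (r : EuclideanSpace ℝ (Fin n)))) =
      (localHomology.openSubsetIso ℤ ℤ hO r'.2 n).inv (g.localClass (r' : EuclideanSpace ℝ (Fin n))) := by
  subst e
  rw [relativeSingularHomology.map_id, ModuleCat.id_apply]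

omit [ChartedSpace (EuclideanSpace ℝ (Fin n)) X] in
/-- **The local class at `c⁻¹ w` is the push-forward of the model class at `w` along
`c⁻¹ : c.target ≃ₜ c.source`, included into `X`** — for a chart `c` agreeing with the
orientation (`μ_y = c^* g_{c y}` on `c.source`), e.g. an atlas chart of a positive atlas or an
open restriction of one. This is the hypothesis shape `(e_i)_* g_{c_i}` of the crossing formula
`TransverseDiscDatum.functional_ofAbsolute_map_eq_sum` with the Euclidean model
`e_i = c⁻¹ : c.target ≃ₜ c.source`. [cite: HatcherAT2002, §3.3 p. 231] -/
theorem HomologicalOrientation.localClass_symm_eq_map_xEquiv (μ : HomologicalOrientation ℤ X n)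
    (g : HomologicalOrientation ℤ (EuclideanSpace ℝ (Fin n)) n)
    (c : OpenPartialHomeomorph X (EuclideanSpace ℝ (Fin n)))
    (hμ : ∀ (y : X) (hy : y ∈ c.source),
      μ.localClass y = (localHomology.chartXEquiv ℤ ℤ c hy n).symm (g.localClass (c y)))
    (r : ↥c.target) :
    relativeSingularHomology.map ℤ ℤ (subsetIncl c.source)
        (localHomology.mapsTo_subsetIncl_compl (c.toHomeomorphSourceTarget.symm r).2) n
        (localHomology.xEquiv ℤ ℤ c.toHomeomorphSourceTarget.symm r n
          ((localHomology.openSubsetIso ℤ ℤ c.open_target r.2 n).inv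
            (g.localClass (r : EuclideanSpace ℝ (Fin n))))) =
      μ.localClass ((c.toHomeomorphSourceTarget.symm r : ↥c.source) : X) := by
  set h := c.toHomeomorphSourceTarget with hh
  set v : localHomology ℤ ℤ ↥c.target r n :=
    (localHomology.openSubsetIso ℤ ℤ c.open_target r.2 n).inv
      (g.localClass (r : EuclideanSpace ℝ (Fin n))) with hv
  have hr : r = h (h.symm r) := (h.apply_symm_apply r).symm
  have hid : MapsTo (ContinuousMap.id ↥c.target) ({r}ᶜ : Set ↥c.target)
      ({h (h.symm r)}ᶜ : Set ↥c.target) := by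
    intro s hs
    change s ∈ ({h (h.symm r)}ᶜ : Set ↥c.target)
    rw [← hr]
    exact hs
  -- KEY: read on `c.target` at `h (h⁻¹ r)`, the pushed class is the excised model class there
  have key : localHomology.xEquiv ℤ ℤ h (h.symm r) n (localHomology.xEquiv ℤ ℤ h.symm r n v) =
      (localHomology.openSubsetIso ℤ ℤ c.open_target (h (h.symm r)).2 n).inv
        (g.localClass ((h (h.symm r) : ↥c.target) : EuclideanSpace ℝ (Fin n))) := by
    rw [localHomology.xEquiv_xEquiv_symm ℤ ℤ h r n v hid, hv,
      map_id_openSubsetIso_inv_localClass g c.open_target r (h (h.symm r)) hr hid]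
  -- the local class in the chart `c`, unfolded (`chartXEquiv c = S⁻¹ ≫ T_h ≫ T`)
  have hdef : μ.localClass ((h.symm r : ↥c.source) : X) =
      (localHomology.openSubsetIso ℤ ℤ c.open_source (h.symm r).2 n).hom
        ((localHomology.xEquiv ℤ ℤ h (h.symm r) n).symm
          ((localHomology.openSubsetIso ℤ ℤ c.open_target (h (h.symm r)).2 n).inv
            (g.localClass ((h (h.symm r) : ↥c.target) : EuclideanSpace ℝ (Fin n))))) := by
    rw [hμ _ (h.symm r).2]
    rfl
  rw [hdef, ← key, LinearEquiv.symm_apply_apply]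
  rfl

/-- **The local classes of the orientation of a positive atlas as push-forwards from the model**:
for an atlas chart `c` and `w ∈ c.target`, `μ_{c⁻¹ w}` is `(c⁻¹)_* g_w` included into `X`.
[cite: Bredon1993, VI.7] -/
theorem positiveAtlasOrientation_localClass_symm (hX : IsPositiveAtlas n X)
    (g : HomologicalOrientation ℤ (EuclideanSpace ℝ (Fin n)) n)
    {c : OpenPartialHomeomorph X (EuclideanSpace ℝ (Fin n))}
    (hc : c ∈ atlas (EuclideanSpace ℝ (Fin n)) X) (r : ↥c.target) :
    relativeSingularHomology.map ℤ ℤ (subsetIncl c.source)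
        (localHomology.mapsTo_subsetIncl_compl (c.toHomeomorphSourceTarget.symm r).2) n
        (localHomology.xEquiv ℤ ℤ c.toHomeomorphSourceTarget.symm r n
          ((localHomology.openSubsetIso ℤ ℤ c.open_target r.2 n).inv
            (g.localClass (r : EuclideanSpace ℝ (Fin n))))) =
      (positiveAtlasOrientation hX g).localClass ((c.toHomeomorphSourceTarget.symm r : ↥c.source) : X) :=
  (positiveAtlasOrientation hX g).localClass_symm_eq_map_xEquiv g c
    (fun _ hy => positiveAtlasOrientation_localClass_eq hX g hc hy) r

/-- The same for the open restriction `c.restrOpen W` of an atlas chart. [cite: Bredon1993, VI.7] -/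
theorem positiveAtlasOrientation_localClass_symm_restrOpen (hX : IsPositiveAtlas n X)
    (g : HomologicalOrientation ℤ (EuclideanSpace ℝ (Fin n)) n)
    {c : OpenPartialHomeomorph X (EuclideanSpace ℝ (Fin n))}
    (hc : c ∈ atlas (EuclideanSpace ℝ (Fin n)) X) {W : Set X} (hW : IsOpen W)
    (r : ↥(c.restrOpen W hW).target) :
    relativeSingularHomology.map ℤ ℤ (subsetIncl (c.restrOpen W hW).source)
        (localHomology.mapsTo_subsetIncl_compl
          ((c.restrOpen W hW).toHomeomorphSourceTarget.symm r).2) n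
        (localHomology.xEquiv ℤ ℤ (c.restrOpen W hW).toHomeomorphSourceTarget.symm r n
          ((localHomology.openSubsetIso ℤ ℤ (c.restrOpen W hW).open_target r.2 n).inv
            (g.localClass (r : EuclideanSpace ℝ (Fin n))))) =
      (positiveAtlasOrientation hX g).localClass
        (((c.restrOpen W hW).toHomeomorphSourceTarget.symm r : ↥(c.restrOpen W hW).source) : X) :=
  (positiveAtlasOrientation hX g).localClass_symm_eq_map_xEquiv g (c.restrOpen W hW)
    (fun _ hy => positiveAtlasOrientation_localClass_restrOpen hX g hc hW hy) r

end PositiveAtlas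

end Literature.AlgebraicTopology.SingularHomology

end
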